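import Mathlib
import Summits.MatrixMultiplication.Statement
import Summits.MatrixMultiplication.MatrixMultiplication.Theorems.GraphEquationsMaskingWitness
import Summits.MatrixMultiplication.MatrixMultiplication.Theorems.GraphEquationsPolarLemma

/-!
# Graph equations — the cubic family `S_{x ⊗ y}` (`n = 2`)

Degree ladder in border currency (NODE-g37): correct QUADRATIC systems are reduced at the origin
(`GraphEquationsQuadricTests`, rung `2`, proved); the degree-`4` masked family of
`GraphEquationsMaskingWitness` is correct and nowhere lowest-form nondegenerate (rung `4`).  Rung `3`
is Conjecture C3 «every correct CUBIC system is generically reduced».  The instrument tests, for a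
polynomial kernel field `N(a,b)`, whether the maximal cubic system killed by `N` is correct; at
`n = 2, 3` every sampled field fails, the hardest being the rank-one fields `N = x ⊗ y`,
`xᵀA ∝ e₁ᵀ`, `By ∝ e₀`.  This file is the formal record of that case:
* `cubicMaskedFamily`: `Σ_i a_{i0} f_{i0}`, `Σ_i a_{i0} f_{i1}`, `Σ_l b_{1l} f_{0l}`,
  `Σ_l b_{1l} f_{1l}`, `Σ_q c_q f_q` (`f = C − AB`) — in `I` (`cubicMaskedFamily_mem`), cubic
  (`cubicMaskedFamily_totalDegree_le`);
* MASKED AT EVERY GRAPH POINT (`EqSystem.not_reducedAt_of_tests_eq`,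
  `EqSystem.not_genericallyReduced_of_tests_eq`): `kerVec = x' ⊗ y'`, `x' = (a₁₀, −a₀₀)`,
  `y' = (b₁₁, −b₁₀)` (or `e₀` where these vanish) is a nonzero kernel vector of the `C`-Jacobian of
  ANY system with these tests at every point of `W_2` — the identity `x'ᵀ(AB)y' = (x'ᵀA)(By') = 0`;
* CORRECT OFF THE ISOTROPIC CONE (`mem_mmGraph_of_eval_eq_zero`): if `(a₀₀²+a₁₀²)(b₁₀²+b₁₁²) ≠ 0`
  and the five cubics vanish at `(A,B,C)` then `C = AB`;
* NOT CORRECT (`eval_cubicMaskedFamily_isoPoint`, `isoPoint_not_mem`,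
  `EqSystem.not_correct_of_tests_eq`): at `A = [[1,0],[i,1]]`, `B = 1`, `C = A + x ⊗ e₀` with the
  isotropic `x = (i,−1)` all five vanish.
So in degree `3` the masking mechanism of degree `4` survives exactly on the isotropic cone (over `ℝ`
this would be a correct nowhere-reduced cubic system): any proof of C3 must use algebraic closedness.
Tags: WEAKER(evidence) support of FRdeg(3); the rung stays UNDECIDED(test: `cubic_ideal_n.py`).
M34 (decomp-mm-lens-5 g37); supports the attacked crux `MultiplicityReduction`
(stmt-MatrixMultiplication-27806) of route `GraphEquations`.  No sorry.
-/

-- dupNamespace: forced by the nested Summit.MatrixMultiplication.MatrixMultiplication layout (D-0017)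
set_option linter.dupNamespace false

noncomputable section

namespace Summit.MatrixMultiplication.MatrixMultiplication.Theorems.GraphEquations

open MvPolynomial Matrix Literature.Computability.AlgebraicComplexity

/-- A matrix of full column rank has trivial kernel (column index any finite type; cf.
`mulVec_eq_zero_imp` for `Fin s`). -/
theorem mulVec_eq_zero_of_rank_eq_card {m ι : Type*} [Fintype m] [Fintype ι] [DecidableEq ι]
    (M : Matrix m ι ℂ) (hM : M.rank = Fintype.card ι) {φ : ι → ℂ} (hφ : M.mulVec φ = 0) : φ = 0 := by
  have hli : LinearIndependent ℂ M.col := by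
    rw [linearIndependent_iff_card_eq_finrank_span, Set.finrank, ← Matrix.rank_eq_finrank_span_cols,
      hM]
  exact Matrix.mulVec_injective_iff.mpr hli (by rw [hφ, Matrix.mulVec_zero])

/-- `a₁₀`. -/ abbrev a10 : GraphVars 2 := Sum.inl (Sum.inl (1, 0))
/-- `a₀₁`. -/ abbrev a01 : GraphVars 2 := Sum.inl (Sum.inl (0, 1))
/-- `a₁₁`. -/ abbrev a11 : GraphVars 2 := Sum.inl (Sum.inl (1, 1))
/-- `b₀₀`. -/ abbrev b00 : GraphVars 2 := Sum.inl (Sum.inr (0, 0))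
/-- `b₀₁`. -/ abbrev b01 : GraphVars 2 := Sum.inl (Sum.inr (0, 1))
/-- `b₁₀`. -/ abbrev b10 : GraphVars 2 := Sum.inl (Sum.inr (1, 0))
/-- `b₁₁`. -/ abbrev b11 : GraphVars 2 := Sum.inl (Sum.inr (1, 1))

/-- `t₁ = a₀₀ f₀₀ + a₁₀ f₁₀` (column `0` of `A` against column `0` of `f`). -/
def cubicT1 : MvPolynomial (GraphVars 2) ℂ := X a00 * generator 2 (0, 0) + X a10 * generator 2 (1, 0)
/-- `t₂ = a₀₀ f₀₁ + a₁₀ f₁₁`. -/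
def cubicT2 : MvPolynomial (GraphVars 2) ℂ := X a00 * generator 2 (0, 1) + X a10 * generator 2 (1, 1)
/-- `t₃ = b₁₀ f₀₀ + b₁₁ f₀₁` (row `1` of `B` against row `0` of `f`). -/
def cubicT3 : MvPolynomial (GraphVars 2) ℂ := X b10 * generator 2 (0, 0) + X b11 * generator 2 (0, 1)
/-- `t₄ = b₁₀ f₁₀ + b₁₁ f₁₁`. -/
def cubicT4 : MvPolynomial (GraphVars 2) ℂ := X b10 * generator 2 (1, 0) + X b11 * generator 2 (1, 1)
/-- `t₅ = Σ_q c_q f_q` (the "sum of squares along the fibre": `Σ_q (φ_q + δ_q) δ_q`). -/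
def cubicT5 : MvPolynomial (GraphVars 2) ℂ := ∑ q : Fin 2 × Fin 2, X (Sum.inr q) * generator 2 q

/-- The cubic masked family `S_{x ⊗ y}`. -/
def cubicMaskedFamily : Fin 5 → MvPolynomial (GraphVars 2) ℂ :=
  ![cubicT1, cubicT2, cubicT3, cubicT4, cubicT5]

/-- Every member lies in the ideal `I` of the graph. -/
theorem cubicMaskedFamily_mem (o : Fin 5) : cubicMaskedFamily o ∈ graphIdeal 2 := by
  have hm : ∀ (g : MvPolynomial (GraphVars 2) ℂ) (q : Fin 2 × Fin 2),
      g * generator 2 q ∈ graphIdeal 2 :=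
    fun g q => Ideal.mul_mem_left _ _ (generator_mem_graphIdeal q)
  fin_cases o
  · exact Ideal.add_mem _ (hm _ _) (hm _ _)
  · exact Ideal.add_mem _ (hm _ _) (hm _ _)
  · exact Ideal.add_mem _ (hm _ _) (hm _ _)
  · exact Ideal.add_mem _ (hm _ _) (hm _ _)
  · show cubicT5 ∈ graphIdeal 2
    exact Ideal.sum_mem _ fun q _ => hm _ q

/-- The members vanish on the graph. -/
theorem eval_cubicMaskedFamily_eq_zero_of_mem {x : GraphVars 2 → ℂ} (hx : x ∈ mmGraph 2) (o : Fin 5) :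
    eval x (cubicMaskedFamily o) = 0 :=
  eval_eq_zero_of_mem_graphIdeal (cubicMaskedFamily_mem o) hx

/-- `deg f_q ≤ 2`. -/
theorem totalDegree_generator_le (q : Fin 2 × Fin 2) : (generator 2 q).totalDegree ≤ 2 := by
  unfold generator
  refine (totalDegree_sub _ _).trans (max_le ?_ ?_)
  · exact (totalDegree_X (R := ℂ) _).le.trans (by norm_num)
  · refine (totalDegree_finsetSum _ _).trans (Finset.sup_le fun k _ => ?_)
    refine (totalDegree_mul _ _).trans ?_
    exact Nat.add_le_add (totalDegree_X (R := ℂ) _).le (totalDegree_X (R := ℂ) _).le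

/-- `deg (v · f_q) ≤ 3` for a variable `v`. -/
theorem totalDegree_X_mul_generator_le (v : GraphVars 2) (q : Fin 2 × Fin 2) :
    (X v * generator 2 q : MvPolynomial (GraphVars 2) ℂ).totalDegree ≤ 3 :=
  (totalDegree_mul _ _).trans (by
    have h1 := (totalDegree_X (R := ℂ) v).le; have h2 := totalDegree_generator_le q; omega)

/-- **The family is CUBIC.** -/
theorem cubicMaskedFamily_totalDegree_le (o : Fin 5) : (cubicMaskedFamily o).totalDegree ≤ 3 := by
  have hadd : ∀ (v w : GraphVars 2) (q q' : Fin 2 × Fin 2),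
      (X v * generator 2 q + X w * generator 2 q' : MvPolynomial (GraphVars 2) ℂ).totalDegree ≤ 3 :=
    fun v w q q' => (totalDegree_add _ _).trans
      (max_le (totalDegree_X_mul_generator_le _ _) (totalDegree_X_mul_generator_le _ _))
  fin_cases o
  · exact hadd _ _ _ _
  · exact hadd _ _ _ _
  · exact hadd _ _ _ _
  · exact hadd _ _ _ _
  · show cubicT5.totalDegree ≤ 3
    exact (totalDegree_finsetSum _ _).trans
      (Finset.sup_le fun q _ => totalDegree_X_mul_generator_le _ _)

/-- `x' = (a₁₀, −a₀₀)`, or `e₀` if that vanishes: `x'ᵀ A = (0, ∗)`. -/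
def xvec (x : GraphVars 2 → ℂ) : Fin 2 → ℂ :=
  if x a00 = 0 ∧ x a10 = 0 then ![1, 0] else ![x a10, -x a00]

/-- `y' = (b₁₁, −b₁₀)`, or `e₀` if that vanishes: `B y' = (∗, 0)`. -/
def yvec (x : GraphVars 2 → ℂ) : Fin 2 → ℂ :=
  if x b10 = 0 ∧ x b11 = 0 then ![1, 0] else ![x b11, -x b10]

/-- The kernel field `N = x' ⊗ y'`. -/
def kerVec (x : GraphVars 2 → ℂ) : Fin 2 × Fin 2 → ℂ := fun q => xvec x q.1 * yvec x q.2

/-- `x' ⊥ column 0 of A`. -/ theorem xvec_rel (x : GraphVars 2 → ℂ) : x a00 * xvec x 0 + x a10 * xvec x 1 = 0 := by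
  unfold xvec
  split_ifs with h
  · simp [h.1, h.2]
  · simp; ring

/-- `y' ⊥ row 1 of B`. -/ theorem yvec_rel (x : GraphVars 2 → ℂ) : x b10 * yvec x 0 + x b11 * yvec x 1 = 0 := by
  unfold yvec
  split_ifs with h
  · simp [h.1, h.2]
  · simp; ring

/-- `x' ≠ 0`. -/ theorem xvec_ne_zero (x : GraphVars 2 → ℂ) : xvec x ≠ 0 := by
  unfold xvec
  split_ifs with h <;> intro h0
  · simpa using congr_fun h0 0
  · exact h ⟨by simpa using congr_fun h0 1, by simpa using congr_fun h0 0⟩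

/-- `y' ≠ 0`. -/ theorem yvec_ne_zero (x : GraphVars 2 → ℂ) : yvec x ≠ 0 := by
  unfold yvec
  split_ifs with h <;> intro h0
  · simpa using congr_fun h0 0
  · exact h ⟨by simpa using congr_fun h0 1, by simpa using congr_fun h0 0⟩

/-- `N = x' ⊗ y' ≠ 0`. -/
theorem kerVec_ne_zero (x : GraphVars 2 → ℂ) : kerVec x ≠ 0 := by
  obtain ⟨i, hi⟩ := Function.ne_iff.mp (xvec_ne_zero x)
  obtain ⟨l, hl⟩ := Function.ne_iff.mp (yvec_ne_zero x)
  intro h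
  have := congr_fun h (i, l)
  simp only [kerVec, Pi.zero_apply, mul_eq_zero] at this
  exact this.elim hi hl

/-- `∂(v·f_q + w·f_{q'})/∂c_r = v·[q = r] + w·[q' = r]` for base variables `v, w`. -/
theorem pderiv_inr_two_terms (v w : MatMulVars 2) (q q' r : Fin 2 × Fin 2) :
    pderiv (Sum.inr r) (X (Sum.inl v) * generator 2 q + X (Sum.inl w) * generator 2 q' :
      MvPolynomial (GraphVars 2) ℂ) =
      X (Sum.inl v) * (if q = r then 1 else 0) + X (Sum.inl w) * (if q' = r then 1 else 0) := by
  classical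
  have hv : pderiv (Sum.inr r) (X (Sum.inl v) : MvPolynomial (GraphVars 2) ℂ) = 0 :=
    pderiv_X_of_ne (Sum.inr_ne_inl).symm
  have hw : pderiv (Sum.inr r) (X (Sum.inl w) : MvPolynomial (GraphVars 2) ℂ) = 0 :=
    pderiv_X_of_ne (Sum.inr_ne_inl).symm
  rw [map_add, (pderiv (Sum.inr r)).leibniz, (pderiv (Sum.inr r)).leibniz, hv, hw,
    pderiv_inr_generator_eq_ite, pderiv_inr_generator_eq_ite]
  simp only [smul_eq_mul, mul_zero, add_zero]

/-- On the graph, `∂t₅/∂c_r = c_r` (`= (AB)_r`). -/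
theorem eval_pderiv_inr_cubicT5 {x : GraphVars 2 → ℂ} (hx : x ∈ mmGraph 2) (r : Fin 2 × Fin 2) :
    eval x (pderiv (Sum.inr r) cubicT5) = x (Sum.inr r) := by
  classical
  have hg : ∀ q : Fin 2 × Fin 2, eval x (generator 2 q) = 0 := (eval_generator_eq_zero_iff x).mpr hx
  unfold cubicT5
  rw [map_sum, map_sum]
  have hterm : ∀ q : Fin 2 × Fin 2, eval x (pderiv (Sum.inr r) (X (Sum.inr q) * generator 2 q)) =
      x (Sum.inr q) * (if q = r then 1 else 0) := fun q => by
    rw [(pderiv (Sum.inr r)).leibniz, pderiv_inr_generator_eq_ite]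
    simp only [smul_eq_mul, map_add, map_mul, eval_X, hg]
    split_ifs <;> simp
  simp only [hterm, mul_ite, mul_one, mul_zero, Finset.sum_ite_eq', Finset.mem_univ, if_true]

/-- Row identity for the bilinear tests: `Σ_r (v [q=r] + w [q'=r]) N_r = v N_q + w N_{q'}`. -/
theorem sum_two_ind_mul (v w : ℂ) (q q' : Fin 2 × Fin 2) (N : Fin 2 × Fin 2 → ℂ) :
    ∑ r : Fin 2 × Fin 2, (v * (if q = r then 1 else 0) + w * (if q' = r then 1 else 0)) * N r =
      v * N q + w * N q' := by
  simp only [add_mul, Finset.sum_add_distrib, mul_ite, mul_one, mul_zero, ite_mul, zero_mul,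
    Finset.sum_ite_eq, Finset.mem_univ, if_true]

/-- **THE KERNEL FIELD.**  At every point of the graph the five Jacobian rows kill `x' ⊗ y'`. -/
theorem sum_eval_pderiv_mul_kerVec {x : GraphVars 2 → ℂ} (hx : x ∈ mmGraph 2) (o : Fin 5) :
    ∑ r : Fin 2 × Fin 2, eval x (pderiv (Sum.inr r) (cubicMaskedFamily o)) * kerVec x r = 0 := by
  classical
  have hxr := xvec_rel x
  have hyr := yvec_rel x
  fin_cases o
  · show ∑ r : Fin 2 × Fin 2, eval x (pderiv (Sum.inr r) cubicT1) * kerVec x r = 0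
    simp only [cubicT1]
    simp only [pderiv_inr_two_terms]
    simp only [map_add, map_mul, eval_X, apply_ite (eval x), map_one, map_zero, sum_two_ind_mul]
    simp only [kerVec]
    linear_combination (yvec x 0) * hxr
  · show ∑ r : Fin 2 × Fin 2, eval x (pderiv (Sum.inr r) cubicT2) * kerVec x r = 0
    simp only [cubicT2]
    simp only [pderiv_inr_two_terms]
    simp only [map_add, map_mul, eval_X, apply_ite (eval x), map_one, map_zero, sum_two_ind_mul]
    simp only [kerVec]
    linear_combination (yvec x 1) * hxr
  · show ∑ r : Fin 2 × Fin 2, eval x (pderiv (Sum.inr r) cubicT3) * kerVec x r = 0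
    simp only [cubicT3]
    simp only [pderiv_inr_two_terms]
    simp only [map_add, map_mul, eval_X, apply_ite (eval x), map_one, map_zero, sum_two_ind_mul]
    simp only [kerVec]
    linear_combination (xvec x 0) * hyr
  · show ∑ r : Fin 2 × Fin 2, eval x (pderiv (Sum.inr r) cubicT4) * kerVec x r = 0
    simp only [cubicT4]
    simp only [pderiv_inr_two_terms]
    simp only [map_add, map_mul, eval_X, apply_ite (eval x), map_one, map_zero, sum_two_ind_mul]
    simp only [kerVec]
    linear_combination (xvec x 1) * hyr
  · show ∑ r : Fin 2 × Fin 2, eval x (pderiv (Sum.inr r) cubicT5) * kerVec x r = 0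
    simp only [eval_pderiv_inr_cubicT5 hx]
    have hc : ∀ i l : Fin 2, x (Sum.inr (i, l)) =
        ∑ j : Fin 2, x (Sum.inl (Sum.inl (i, j))) * x (Sum.inl (Sum.inr (j, l))) := hx
    simp only [Fintype.sum_prod_type, Fin.sum_univ_two, hc, kerVec]
    simp only [a00, a10, b10, b11] at hxr hyr
    linear_combination (x b00 * yvec x 0 + x b01 * yvec x 1) * hxr +
      (x a01 * xvec x 0 + x a11 * xvec x 1) * hyr

namespace EqSystem

/-- For a system whose tests are the cubic family, `x' ⊗ y'` is in the kernel of the `C`-Jacobian at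
every graph point. -/
theorem jacobianC_mulVec_kerVec {E : EqSystem 2} (hlen : E.tests.length = 5)
    (hE : ∀ o : Fin E.tests.length, E.testPoly (E.tests.get o) = cubicMaskedFamily (Fin.cast hlen o))
    {x : GraphVars 2 → ℂ} (hx : x ∈ mmGraph 2) : (E.jacobianC x).mulVec (kerVec x) = 0 := by
  funext o
  simp only [Matrix.mulVec, dotProduct, jacobianC, Matrix.of_apply, hE, Pi.zero_apply]
  exact sum_eval_pderiv_mul_kerVec hx _

/-- **MASKED AT EVERY GRAPH POINT.**  No system with these tests is reduced at any point of `W_2`. -/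
theorem not_reducedAt_of_tests_eq {E : EqSystem 2} (hlen : E.tests.length = 5)
    (hE : ∀ o : Fin E.tests.length, E.testPoly (E.tests.get o) = cubicMaskedFamily (Fin.cast hlen o))
    {x : GraphVars 2 → ℂ} (hx : x ∈ mmGraph 2) : ¬ E.ReducedAt x := by
  intro hred
  have hcard : (E.jacobianC x).rank = Fintype.card (Fin 2 × Fin 2) := by
    rw [Fintype.card_prod, Fintype.card_fin]; exact hred
  have h := mulVec_eq_zero_of_rank_eq_card (E.jacobianC x) hcard (jacobianC_mulVec_kerVec hlen hE hx)
  exact kerVec_ne_zero x h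

/-- Hence no such system is generically reduced. -/
theorem not_genericallyReduced_of_tests_eq {E : EqSystem 2} (hlen : E.tests.length = 5)
    (hE : ∀ o : Fin E.tests.length, E.testPoly (E.tests.get o) = cubicMaskedFamily (Fin.cast hlen o)) :
    ¬ E.GenericallyReduced := by
  rintro ⟨x, hx, hred⟩
  exact not_reducedAt_of_tests_eq hlen hE hx hred

end EqSystem

/-- **OFF THE ISOTROPIC CONE THE FIVE CUBICS CUT OUT THE GRAPH.**  If
`(a₀₀² + a₁₀²)(b₁₀² + b₁₁²) ≠ 0` and all five vanish at `x = (A,B,C)` then `C = AB`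
(the fibre equations force `C − AB = s · x' ⊗ y'` and then `s² |x'|² |y'|² = 0`). -/
theorem mem_mmGraph_of_eval_eq_zero {x : GraphVars 2 → ℂ} (hα : x a00 ^ 2 + x a10 ^ 2 ≠ 0)
    (hβ : x b10 ^ 2 + x b11 ^ 2 ≠ 0) (h : ∀ o, eval x (cubicMaskedFamily o) = 0) : x ∈ mmGraph 2 := by
  classical
  set δ : Fin 2 × Fin 2 → ℂ := fun q => eval x (generator 2 q) with hδdef
  have hc : ∀ i l : Fin 2, x (Sum.inr (i, l)) =
      (∑ k : Fin 2, x (Sum.inl (Sum.inl (i, k))) * x (Sum.inl (Sum.inr (k, l)))) + δ (i, l) :=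
    fun i l => by simp only [hδdef, generator, map_sub, map_sum, map_mul, eval_X]; ring
  have E1 : x a00 * δ (0, 0) + x a10 * δ (1, 0) = 0 := by simpa [cubicMaskedFamily, cubicT1] using h 0
  have E2 : x a00 * δ (0, 1) + x a10 * δ (1, 1) = 0 := by simpa [cubicMaskedFamily, cubicT2] using h 1
  have E3 : x b10 * δ (0, 0) + x b11 * δ (0, 1) = 0 := by simpa [cubicMaskedFamily, cubicT3] using h 2
  have E4 : x b10 * δ (1, 0) + x b11 * δ (1, 1) = 0 := by simpa [cubicMaskedFamily, cubicT4] using h 3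
  have E5 : ∑ q : Fin 2 × Fin 2, x (Sum.inr q) * δ q = 0 := by
    simpa [cubicMaskedFamily, cubicT5] using h 4
  simp only [Fintype.sum_prod_type, Fin.sum_univ_two, hc] at E5
  simp only [a00, a10, b10, b11] at E1 E2 E3 E4 hα hβ
  set A0 : ℂ := x (Sum.inl (Sum.inl (0, 0)))
  set A1 : ℂ := x (Sum.inl (Sum.inl (1, 0)))
  set A2 : ℂ := x (Sum.inl (Sum.inl (0, 1)))
  set A3 : ℂ := x (Sum.inl (Sum.inl (1, 1)))
  set B0 : ℂ := x (Sum.inl (Sum.inr (1, 0)))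
  set B1 : ℂ := x (Sum.inl (Sum.inr (1, 1)))
  set B2 : ℂ := x (Sum.inl (Sum.inr (0, 0)))
  set B3 : ℂ := x (Sum.inl (Sum.inr (0, 1)))
  have hsq : δ (0, 0) ^ 2 + δ (0, 1) ^ 2 + δ (1, 0) ^ 2 + δ (1, 1) ^ 2 = 0 := by
    linear_combination E5 - B2 * E1 - B3 * E2 - A2 * E3 - A3 * E4
  set w0 := A1 * δ (0, 0) - A0 * δ (1, 0) with hw0
  set w1 := A1 * δ (0, 1) - A0 * δ (1, 1) with hw1
  set z := B1 * w0 - B0 * w1 with hz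
  have hd00 : (A0 ^ 2 + A1 ^ 2) * δ (0, 0) = A1 * w0 := by linear_combination A0 * E1
  have hd10 : (A0 ^ 2 + A1 ^ 2) * δ (1, 0) = -(A0 * w0) := by linear_combination A1 * E1
  have hd01 : (A0 ^ 2 + A1 ^ 2) * δ (0, 1) = A1 * w1 := by linear_combination A0 * E2
  have hd11 : (A0 ^ 2 + A1 ^ 2) * δ (1, 1) = -(A0 * w1) := by linear_combination A1 * E2
  have hwβ : B0 * w0 + B1 * w1 = 0 := by linear_combination A1 * E3 - A0 * E4
  have hz0 : (B0 ^ 2 + B1 ^ 2) * w0 = B1 * z := by linear_combination B0 * hwβ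
  have hz1 : (B0 ^ 2 + B1 ^ 2) * w1 = -(B0 * z) := by linear_combination B1 * hwβ
  have hw : w0 ^ 2 + w1 ^ 2 = 0 := by
    have h1 : (A0 ^ 2 + A1 ^ 2) ^ 2 * (δ (0, 0) ^ 2 + δ (0, 1) ^ 2 + δ (1, 0) ^ 2 + δ (1, 1) ^ 2) =
        (A0 ^ 2 + A1 ^ 2) * (w0 ^ 2 + w1 ^ 2) := by
      linear_combination ((A0 ^ 2 + A1 ^ 2) * δ (0, 0) + A1 * w0) * hd00 +
        ((A0 ^ 2 + A1 ^ 2) * δ (1, 0) - A0 * w0) * hd10 +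
        ((A0 ^ 2 + A1 ^ 2) * δ (0, 1) + A1 * w1) * hd01 +
        ((A0 ^ 2 + A1 ^ 2) * δ (1, 1) - A0 * w1) * hd11
    rw [hsq, mul_zero] at h1
    exact (mul_eq_zero.mp h1.symm).resolve_left hα
  have hz' : z = 0 := by
    have h2 : (B0 ^ 2 + B1 ^ 2) ^ 2 * (w0 ^ 2 + w1 ^ 2) = (B0 ^ 2 + B1 ^ 2) * z ^ 2 := by
      linear_combination
        ((B0 ^ 2 + B1 ^ 2) * w0 + B1 * z) * hz0 + ((B0 ^ 2 + B1 ^ 2) * w1 - B0 * z) * hz1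
    rw [hw, mul_zero] at h2
    exact pow_eq_zero_iff (n := 2) (by norm_num) |>.mp ((mul_eq_zero.mp h2.symm).resolve_left hβ)
  have hw0' : w0 = 0 := (mul_eq_zero.mp (hz0.trans (by rw [hz', mul_zero]))).resolve_left hβ
  have hw1' : w1 = 0 := (mul_eq_zero.mp (hz1.trans (by rw [hz', mul_zero, neg_zero]))).resolve_left hβ
  have k00 := (mul_eq_zero.mp (hd00.trans (by rw [hw0', mul_zero]))).resolve_left hα
  have k10 := (mul_eq_zero.mp (hd10.trans (by rw [hw0', mul_zero, neg_zero]))).resolve_left hα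
  have k01 := (mul_eq_zero.mp (hd01.trans (by rw [hw1', mul_zero]))).resolve_left hα
  have k11 := (mul_eq_zero.mp (hd11.trans (by rw [hw1', mul_zero, neg_zero]))).resolve_left hα
  refine (eval_generator_eq_zero_iff x).mp ?_
  rintro ⟨i, l⟩
  fin_cases i <;> fin_cases l
  exacts [k00, k01, k10, k11]

/-- The point `A = [[1,0],[i,1]]`, `B = 1`, `C = A + x ⊗ y` with the ISOTROPIC `x = (i, −1)`,
`y = (1, 0)`: `C = [[1 + i, 0], [i − 1, 1]]`. -/
def isoPoint : GraphVars 2 → ℂ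
  | Sum.inl (Sum.inl q) => ![![1, 0], ![Complex.I, 1]] q.1 q.2
  | Sum.inl (Sum.inr q) => if q.1 = q.2 then 1 else 0
  | Sum.inr q => ![![1 + Complex.I, 0], ![Complex.I - 1, 1]] q.1 q.2

/-- The fibre values `f_q(isoPoint) = (x ⊗ y)_q = (i, 0, −1, 0)`. -/
theorem eval_generator_isoPoint (q : Fin 2 × Fin 2) :
    eval isoPoint (generator 2 q) = ![![Complex.I, 0], ![-1, 0]] q.1 q.2 := by
  obtain ⟨i, l⟩ := q
  fin_cases i <;> fin_cases l <;> simp [generator, isoPoint, Fin.sum_univ_two]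

/-- **All five cubics vanish at the isotropic point.** -/
theorem eval_cubicMaskedFamily_isoPoint (o : Fin 5) : eval isoPoint (cubicMaskedFamily o) = 0 := by
  fin_cases o
  · show eval isoPoint cubicT1 = 0
    simp [cubicT1, eval_generator_isoPoint, isoPoint]
  · show eval isoPoint cubicT2 = 0
    simp [cubicT2, eval_generator_isoPoint, isoPoint]
  · show eval isoPoint cubicT3 = 0
    simp [cubicT3, eval_generator_isoPoint, isoPoint]
  · show eval isoPoint cubicT4 = 0
    simp [cubicT4, eval_generator_isoPoint, isoPoint]
  · show eval isoPoint cubicT5 = 0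
    simp [cubicT5, eval_generator_isoPoint, isoPoint, Fintype.sum_prod_type, Fin.sum_univ_two]
    linear_combination Complex.I_sq

/-- **… and it is not on the graph** (`c₀₀ = 1 + i ≠ 1 = (AB)₀₀`). -/
theorem isoPoint_not_mem : isoPoint ∉ mmGraph 2 := by
  intro h
  have h00 := h 0 0
  simp [isoPoint] at h00

/-- The isotropic point lies on the cone `(a₀₀² + a₁₀²)(b₁₀² + b₁₁²) = 0`. -/
theorem isoPoint_isotropic : isoPoint a00 ^ 2 + isoPoint a10 ^ 2 = 0 := by
  simp [isoPoint, Complex.I_sq]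

namespace EqSystem

/-- The zero set of a system with the cubic tests contains the isotropic point … -/
theorem isoPoint_mem_zeroSet_of_tests_eq {E : EqSystem 2} (hlen : E.tests.length = 5)
    (hE : ∀ o : Fin E.tests.length, E.testPoly (E.tests.get o) = cubicMaskedFamily (Fin.cast hlen o)) :
    isoPoint ∈ E.zeroSet := by
  intro j hj
  obtain ⟨o, rfl⟩ := List.get_of_mem hj
  rw [hE]
  exact eval_cubicMaskedFamily_isoPoint _

/-- … and is therefore NOT the graph: **the cubic family is not correct over `ℂ`.** -/
theorem not_correct_of_tests_eq {E : EqSystem 2} (hlen : E.tests.length = 5)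
    (hE : ∀ o : Fin E.tests.length, E.testPoly (E.tests.get o) = cubicMaskedFamily (Fin.cast hlen o)) :
    ¬ E.Correct := by
  rintro ⟨-, hZ⟩
  have h := isoPoint_mem_zeroSet_of_tests_eq hlen hE
  rw [hZ] at h
  exact isoPoint_not_mem h

end EqSystem

end Summit.MatrixMultiplication.MatrixMultiplication.Theorems.GraphEquations

end
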